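import Summits.QuantumFields.BalabanUV.T4Continuum.Support.NE7StraightSliceB5ChartForms
import Summits.QuantumFields.BalabanUV.T4Continuum.Support.NE7StraightSliceB5Gauge
import Summits.QuantumFields.BalabanUV.T4Continuum.Support.NE7StraightSliceB5Green
import Summits.QuantumFields.BalabanUV.T4Continuum.Support.NE7StraightSliceB5GreenSplit
import Summits.QuantumFields.BalabanUV.T4Continuum.Support.NE7StraightSliceB5AdjointSup
import HarnessLib

/-!
# NE7StraightSliceB5Transfer — row NE7 (node U5), the (A)-bill's XL(c) docking, file D5 (vii) of `t4/b2b-balaban-t4-ne7-p2/g84/XLC-DOCKING-MEMO.md` §7: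
# (142)'s RANK-ONE STRAIGHT SOURCE LETTER `h1src` — HENCE F54 v3's SLICE SOLVER LETTER `hG` — FROM ONE LETTER STATED ENTIRELY ON lit-balaban's TORUS IN lit-balaban's
# SYMBOLS: «curl-only constrained weak solutions in `ker Q_k` have sup-bounded curl», with `K₁ = L^j · K` (the unit `η⁻¹ = L^j` of (1.2))

Lineage `b2b-balaban-t4-ne7-p2` (CRUX PROVER NE7 #2, co-owner of row NE7), generation 84 (staged behind (143)–(146)'s oleans).  Over (143) `NE7StraightSliceB5Chart`
(`toB5`, `iterate_Qcoarse_eq_zero_iff_QvOp`), (144) `NE7StraightSliceB5ChartCurl` (`CurlOp_mulVec_toB5`, `norm_fin_one`, `norm_toB5`, the inverse transfer `ofB5`,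
`curlAt_flat_liftT_mkT`), (145) `NE7StraightSliceB5ChartForms` (`hess_flat_eq_re_form_CurlOp`, `srcPair_eq_re_dotProduct`, `conj_entry_of_skew`), (146) `NE7StraightSliceB5Gauge`
(`weak_curl_of_imaginary_tests`, `curlForm_natCast`, `weak_DeltaA_gaugeT_lambda0`, `eq_of_weak_DeltaA`), (148) `NE7StraightSliceB5Green` (`cGreen`), (149)
`NE7StraightSliceB5GreenSplit`, (150) `NE7StraightSliceB5AdjointSup`.
WHAT ([folklore] bookkeeping).  §1 purely imaginary vectors: their `star`-pairings are real and symmetric (`conj_dotProduct_of_imaginary`, `dotProduct_comm_of_imaginary`), `CurlOp 1`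
and `toB5` of skew fields preserve them.  §2 **`weak_curl_one_of_hess`**: the T4 weak equation `hess 1 ξ ζ (perWin d P) = srcPair h ζ (periodBox P)` for all skew `P`-periodic
straight `ζ` (`P = L^j·N`) gives, on lit-balaban's torus `Tor (fine L^j (N,…,N))`, `½⟨∂_1β, ∂_1(toB5 ξ)⟩ = ⟨β, toB5 h⟩` for every purely imaginary `β ∈ ker Q_k` (the test
behind `β` is `ofB5 β`).  §3 **`rankOneSourceSolver_of_B5`** — THE DOCKED LETTER: displayed hypothesis `hB` (lit-balaban's torus and symbols only: for purely imaginary `α ∈ ker Q_k`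
and `J`, if `½⟨∂_n β, ∂_n α⟩ = ⟨β, J⟩` for all `β ∈ ker Q_k` (`n = L^j = η⁻¹`, `∂_n = CurlOp (fine n M) n` as in `Δ_a`) and `|J| ≤ g` pointwise, then `|∂_n α| ≤ K·g` pointwise);
conclusion: (142)'s `h1src` VERBATIM (`N := Mc`) with `K₁ = L^j·K` — so, with (142) `sliceSolver_end_of_rankOneSourceSolver`, F54 v3's `hG` follows from `hB`.  §4 the same from
a sup bound on the curl of `Δ_a`'s constrained weak solutions (**`rankOneSourceSolver_of_DeltaA_weak_bound`**, via (146) `weak_DeltaA_gaugeT_lambda0`), and from ANY constrained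
solution operator `C` of `Δ_a` on `ker Q_k` with `|∂_n(CJ)| ≤ K·sup|J|` (**`rankOneSourceSolver_of_solutionOperator`**, via (146)'s uniqueness `eq_of_weak_DeltaA`) — the
constrained Green field `GJ − GQ*(QGQ*)⁻¹QGJ` of (140)∕(148) is such a `C` — §5 **`rankOneSourceSolver_of_cGreen_bound`**: `h1src` (`K₁ = L^j·K`) from the ONE
hypothesis `|∂_n(cGreen·J)| ≤ K·g whenever |J| ≤ g` — THE WHOLE REMAINING CONTENT OF THE (A)-BILL's XL(c); §6 **`rankOneSourceSolver_of_threeBounds`**: the same from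
BAŁABAN's THREE PRINTED SUP BOUNDS `|∂_n GJ| ≤ C₁|J|`, `|GJ| ≤ C₀|J|` ((1.115) for `G`), `|∂_n H_kB| ≤ C_H|B|` (`H_k = GQ*(QGQ*)⁻¹` (1.103)), via (149)
`NE7StraightSliceB5GreenSplit` — `K₁ = L^j·(C₁ + C_H·C₀)`; §7 **`rankOneSourceSolver_of_G115_QGQinv`**: with (150) `NE7StraightSliceB5AdjointSup` (`|Q*w|_∞ ≤ |w|_∞`, so
`C_H = C₁·C_E`) the same from (1.115) for `G` (PROVED in lit-balaban on the family of record; dictionary step the OWNER's — ask the G-an2-4 team's (B5-1115-TABLE) first) plus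
ONE sup bound `hE` for `(QGQ*)⁻¹` (NOT yet in lit-balaban): `K₁ = L^j·(C₁ + C₁·C_E·C₀)`.
HONEST FRAMING (page 1): [folklore] index∕unit bookkeeping; NO estimate — the letter `hB` is DISPLAYED, not proved; nothing of Bałaban's asserted; NOT (APE), NOT ONE-STEP, NOT NE7;
spine 0∕9; finite T⁴ rung (B)+1 — NOT infinite volume, NOT mass gap, NOT Clay.  Continuum YM on T⁴ ⇐ BetaPertH ∧ nine spine estimates (0/9 proved); BetaPertH ⇐ (D1) ∧ (D4) ∧
CAP+tail; G-an2-4 gates asym, D1 and NE2/3/4.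
-/

set_option autoImplicit false

open scoped BigOperators Matrix Matrix.Norms.L2Operator ComplexConjugate
open Finset

namespace Summit.QuantumFields.BalabanUV.T4Continuum.NE7StraightSliceB5Transfer

open Literature.MathematicalPhysics.QuantumFieldTheory.Balaban1983to89
open B7Prop1Explicit
open B5Prop11Plancherel (Tor fine)
open B5Action121 (CurlOp CurlOp_mulVec Fs_apply star_mulVec_dotProduct)
open B5Block118 (QvOp)
open T4AveragingDeficitWall (curlAt IsSkewDir)
open T4AveragingDeficitWallBoundary (periodBox)
open AveragingDeficitPeriodicCounting (IsPeriodicDir)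
open MinimalActionLevels (perWin)
open BlockAveragePushDirSplit (flat)
open NE3HessForm (hess)
open NE3TangentFlatStructure (Qcoarse)
open NE7FlatSliceSourceDuality (srcPair)
open NE7StraightSliceB5Chart (liftT toB5 toB5_apply iterate_Qcoarse_eq_zero_iff_QvOp)
open NE7StraightSliceB5ChartCurl (CurlOp_mulVec_toB5 norm_fin_one norm_toB5 mkT ofB5 toB5_ofB5 ofB5_periodic ofB5_skew curlAt_flat_liftT_mkT)
open NE7StraightSliceB5ChartForms (conj_entry_of_skew hess_flat_eq_re_form_CurlOp srcPair_eq_re_dotProduct)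
open NE7StraightSliceB5Gauge (weak_curl_of_imaginary_tests curlForm_natCast weak_DeltaA_gaugeT_lambda0 eq_of_weak_DeltaA)
open B5DeltaA169 (DeltaA)
open NE7StraightSliceB5Green (cGreen QvOp_mulVec_cGreen form_DeltaA_cGreen)
open NE7StraightSliceB5GreenSplit (cSplit_solutionOperator curl_cSplit_bound)
open B5Prop11Plancherel (calG)
open Beta.FluctuationProjection (Hk QGQ)
open NE7StraightSliceB5AdjointSup (curl_Hk_bound)

noncomputable section

variable {d : ℕ}

local notation "𝕄₁" => Matrix (Fin 1) (Fin 1) ℂ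

/-! ## §1 Purely imaginary vectors: real symmetric pairings; `∂_1` and the transfer of skew fields preserve them -/

/-- The `star`-pairing of two purely imaginary vectors is real. [folklore] -/
theorem conj_dotProduct_of_imaginary {ι : Type*} [Fintype ι] {u w : ι → ℂ} (hu : ∀ i, conj (u i) = -u i) (hw : ∀ i, conj (w i) = -w i) :
    conj (star u ⬝ᵥ w) = star u ⬝ᵥ w := by
  rw [dotProduct, map_sum]
  refine Finset.sum_congr rfl fun i _ => ?_
  rw [Pi.star_apply, Complex.star_def, map_mul, Complex.conj_conj, hu, hw]
  ring

/-- … and symmetric. [folklore] -/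
theorem dotProduct_comm_of_imaginary {ι : Type*} [Fintype ι] {u w : ι → ℂ} (hu : ∀ i, conj (u i) = -u i) (hw : ∀ i, conj (w i) = -w i) :
    star u ⬝ᵥ w = star w ⬝ᵥ u := by
  have h : star u ⬝ᵥ w = conj (star w ⬝ᵥ u) := by
    rw [dotProduct, dotProduct, map_sum]
    refine Finset.sum_congr rfl fun i _ => ?_
    rw [Pi.star_apply, Pi.star_apply, Complex.star_def, map_mul, Complex.conj_conj, mul_comm]
  rw [h, conj_dotProduct_of_imaginary hw hu]

/-- `∂_1` (real coefficients) maps purely imaginary vector fields to purely imaginary plaquette fields. [cite: Balaban1984PropagatorsI, (1.2) p.18] -/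
theorem CurlOp_one_imaginary (N : Fin d → ℕ) [∀ μ, NeZero (N μ)] {u : Tor N × Fin d → ℂ} (hu : ∀ p, conj (u p) = -u p)
    (p : Tor N × (Fin d × Fin d)) : conj ((CurlOp N 1 *ᵥ u) p) = -(CurlOp N 1 *ᵥ u) p := by
  obtain ⟨x, μ, ν⟩ := p
  rw [CurlOp_mulVec, Fs_apply, one_mul, map_sub, map_sub, map_add, hu, hu, hu, hu]
  ring

/-- The transfer of a skew rank-one field is purely imaginary. [folklore] -/
theorem toB5_imaginary {N : Fin d → ℕ} {ξ : Site d → Fin d → 𝕄₁} (hξ : IsSkewDir ξ) (p : Tor N × Fin d) :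
    conj (toB5 (N := N) ξ p) = -toB5 (N := N) ξ p := by
  obtain ⟨x, κ⟩ := p
  rw [toB5_apply]
  exact conj_entry_of_skew hξ _ _

/-! ## §2 The T4 weak equation on lit-balaban's torus, at lattice factor `c = 1`, for the purely imaginary tests of `ker Q_k` -/

/-- **THE T4 WEAK EQUATION READ ON THE TORUS**: if `hess 1 ξ ζ (perWin d P) = srcPair h ζ (periodBox P)` for every skew `P`-periodic straight `ζ` (`P = L^j·N ≥ 2`, `ξ` skew
`P`-periodic, `h` skew), then `½⟨∂_1β, ∂_1(toB5 ξ)⟩ = ⟨β, toB5 h⟩` for every purely imaginary `β ∈ ker Q_k` on `Tor (fine L^j (N,…,N))` — the test behind `β` is `ofB5 β`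
((144): skew, periodic, `toB5 (ofB5 β) = β`; straight by (143)). [folklore] -/
theorem weak_curl_one_of_hess {L : ℕ} [NeZero L] (hL : 1 ≤ L) (j Mc : ℕ) [NeZero Mc] (hP : 2 ≤ L ^ j * Mc) {ξ h : Site d → Fin d → 𝕄₁}
    (hξs : IsSkewDir ξ) (hξP : IsPeriodicDir ξ ((L ^ j * Mc : ℕ) : ℤ)) (hhs : IsSkewDir h)
    (hweak : ∀ ζ : Site d → Fin d → 𝕄₁, IsSkewDir ζ → IsPeriodicDir ζ ((L ^ j * Mc : ℕ) : ℤ) → (Qcoarse L)^[j] ζ = 0 →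
      hess (flat (d := d) (n := Fin 1)) ξ ζ (perWin d (L ^ j * Mc)) = srcPair h ζ (periodBox (d := d) (L ^ j * Mc)))
    (β : Tor (fine (L ^ j) fun _ : Fin d => Mc) × Fin d → ℂ) (hβ : QvOp (L ^ j) (fun _ : Fin d => Mc) *ᵥ β = 0) (hβim : ∀ p, conj (β p) = -β p) :
    (1 / 2 : ℂ) * (star (CurlOp (fine (L ^ j) fun _ : Fin d => Mc) 1 *ᵥ β) ⬝ᵥ (CurlOp (fine (L ^ j) fun _ : Fin d => Mc) 1 *ᵥ toB5 ξ))
      = star β ⬝ᵥ toB5 h := by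
  -- the test field behind `β`
  have hζP : IsPeriodicDir (ofB5 (P := L ^ j * Mc) β) ((L ^ j * Mc : ℕ) : ℤ) := ofB5_periodic (P := L ^ j * Mc) β
  have hζs : IsSkewDir (ofB5 (P := L ^ j * Mc) β) := ofB5_skew hβim
  have hζβ : toB5 (N := fun _ : Fin d => L ^ j * Mc) (ofB5 (P := L ^ j * Mc) β) = β := toB5_ofB5 (P := L ^ j * Mc) β
  have hζ0 : (Qcoarse L)^[j] (ofB5 (P := L ^ j * Mc) β) = 0 := by
    refine (iterate_Qcoarse_eq_zero_iff_QvOp hL j Mc hζP).mpr ?_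
    have e : (toB5 (ofB5 (P := L ^ j * Mc) β) : Tor (fine (L ^ j) fun _ : Fin d => Mc) × Fin d → ℂ) = β := hζβ
    rw [e, hβ]
  have hw := hweak _ hζs hζP hζ0
  rw [hess_flat_eq_re_form_CurlOp (L ^ j * Mc) hP hξP hζs hζP, srcPair_eq_re_dotProduct (L ^ j * Mc), hζβ, ← Matrix.mulVec_mulVec,
    ← star_mulVec_dotProduct] at hw
  -- `hw` is the identity of real parts, at the chart's torus `Tor (P,…,P)` (definitionally lit-balaban's `Tor (fine L^j (N,…,N))`); both pairings are real
  have key : (1 / 2 : ℂ) * (star (CurlOp (fun _ : Fin d => L ^ j * Mc) 1 *ᵥ β) ⬝ᵥ (CurlOp (fun _ : Fin d => L ^ j * Mc) 1 *ᵥ toB5 (N := fun _ : Fin d => L ^ j * Mc) ξ))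
      = star β ⬝ᵥ toB5 (N := fun _ : Fin d => L ^ j * Mc) h := by
    have h1 := conj_dotProduct_of_imaginary (CurlOp_one_imaginary (fun _ : Fin d => L ^ j * Mc) (u := β) hβim)
      (CurlOp_one_imaginary (fun _ : Fin d => L ^ j * Mc) (toB5_imaginary (N := fun _ : Fin d => L ^ j * Mc) hξs))
    have h2 := conj_dotProduct_of_imaginary (toB5_imaginary (N := fun _ : Fin d => L ^ j * Mc) hhs) hβim
    rw [dotProduct_comm_of_imaginary hβim (toB5_imaginary (N := fun _ : Fin d => L ^ j * Mc) hhs), ← Complex.conj_eq_iff_re.mp h1,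
      ← Complex.conj_eq_iff_re.mp h2, ← hw]
    push_cast
    ring
  exact key

/-! ## §3 The docked letter -/

/-- **(142)'s RANK-ONE STRAIGHT SOURCE LETTER FROM ONE LETTER ON lit-balaban's TORUS.**  HYPOTHESIS `hB` (DISPLAYED; lit-balaban's torus `Tor (fine L^j (N,…,N))` and
symbols only): for purely imaginary `α ∈ ker Q_k` and purely imaginary `J`, if `½⟨∂_n β, ∂_n α⟩ = ⟨β, J⟩` for all `β ∈ ker Q_k` (`n = L^j`, `∂_n = CurlOp (fine n M) n`, the curl
form of `Δ_a` (1.69)) and `|J| ≤ g` pointwise, then `|∂_n α| ≤ K·g` pointwise.  CONCLUSION: (142)'s `h1src` verbatim, `K₁ = L^j·K`.  By (146) the `α` of `hB` is, up to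
Bałaban's gauge `λ₀`, THE `Δ_a`-constrained weak solution, so `hB` is a statement about Bałaban's Green operator (steps (vi), the OWNER's). [folklore] -/
theorem rankOneSourceSolver_of_B5 {L : ℕ} [NeZero L] (hL : 1 ≤ L) (j Mc : ℕ) [NeZero Mc] (hP : 2 ≤ L ^ j * Mc) {K : ℝ}
    (hB : ∀ α J : Tor (fine (L ^ j) fun _ : Fin d => Mc) × Fin d → ℂ,
      (∀ p, conj (α p) = -α p) → (∀ p, conj (J p) = -J p) → QvOp (L ^ j) (fun _ : Fin d => Mc) *ᵥ α = 0 →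
      (∀ β : Tor (fine (L ^ j) fun _ : Fin d => Mc) × Fin d → ℂ, QvOp (L ^ j) (fun _ : Fin d => Mc) *ᵥ β = 0 →
        (1 / 2 : ℂ) * (star (CurlOp (fine (L ^ j) fun _ : Fin d => Mc) ((L ^ j : ℕ) : ℂ) *ᵥ β)
          ⬝ᵥ (CurlOp (fine (L ^ j) fun _ : Fin d => Mc) ((L ^ j : ℕ) : ℂ) *ᵥ α)) = star β ⬝ᵥ J) →
      ∀ g : ℝ, (∀ p, ‖J p‖ ≤ g) →
        ∀ (x : Tor (fine (L ^ j) fun _ : Fin d => Mc)) (μ ν : Fin d),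
          ‖(CurlOp (fine (L ^ j) fun _ : Fin d => Mc) ((L ^ j : ℕ) : ℂ) *ᵥ α) (x, (μ, ν))‖ ≤ K * g) :
    ∀ ξ : Site d → Fin d → 𝕄₁, IsSkewDir ξ → IsPeriodicDir ξ ((L ^ j * Mc : ℕ) : ℤ) → (Qcoarse L)^[j] ξ = 0 →
      ∀ h : Site d → Fin d → 𝕄₁, IsSkewDir h → IsPeriodicDir h ((L ^ j * Mc : ℕ) : ℤ) → ∀ g : ℝ, 0 ≤ g → (∀ (x : Site d) (κ : Fin d), ‖h x κ‖ ≤ g) →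
      (∀ ζ : Site d → Fin d → 𝕄₁, IsSkewDir ζ → IsPeriodicDir ζ ((L ^ j * Mc : ℕ) : ℤ) → (Qcoarse L)^[j] ζ = 0 →
        hess (flat (d := d) (n := Fin 1)) ξ ζ (perWin d (L ^ j * Mc)) = srcPair h ζ (periodBox (d := d) (L ^ j * Mc))) →
      ∀ (z : Site d) (μ ν : Fin d), μ ≠ ν → ‖curlAt (flat (d := d) (n := Fin 1)) ξ z μ ν‖ ≤ (((L ^ j : ℕ) : ℝ) * K) * g := by
  intro ξ hξs hξP hξ0 h hhs _hhP g _hg hhg hweak z μ ν _hμν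
  -- the transfers, at lit-balaban's torus of record
  have hαQ : QvOp (L ^ j) (fun _ : Fin d => Mc) *ᵥ toB5 ξ = 0 := (iterate_Qcoarse_eq_zero_iff_QvOp hL j Mc hξP).mp hξ0
  have hαim : ∀ p : Tor (fine (L ^ j) fun _ : Fin d => Mc) × Fin d, conj (toB5 ξ p) = -toB5 ξ p := toB5_imaginary hξs
  -- `c = 1`: the weak equation for ALL `β ∈ ker Q_k` ((146) §6 over the imaginary tests of §2)
  have hw1 : ∀ β : Tor (fine (L ^ j) fun _ : Fin d => Mc) × Fin d → ℂ, QvOp (L ^ j) (fun _ : Fin d => Mc) *ᵥ β = 0 →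
      (1 / 2 : ℂ) * (star (CurlOp (fine (L ^ j) fun _ : Fin d => Mc) 1 *ᵥ β) ⬝ᵥ (CurlOp (fine (L ^ j) fun _ : Fin d => Mc) 1 *ᵥ toB5 ξ))
        = star β ⬝ᵥ toB5 h :=
    fun β hβ => weak_curl_of_imaginary_tests (L ^ j) (fun _ : Fin d => Mc) 1
      (fun β' hβ' hβ'im => weak_curl_one_of_hess hL j Mc hP hξs hξP hhs hweak β' hβ' hβ'im) β hβ
  -- units: `c = n = L^j`, source `J = n² • toB5 h`
  set J : Tor (fine (L ^ j) fun _ : Fin d => Mc) × Fin d → ℂ := (((L ^ j : ℕ) : ℂ) ^ 2) • toB5 h with hJ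
  have hwn : ∀ β : Tor (fine (L ^ j) fun _ : Fin d => Mc) × Fin d → ℂ, QvOp (L ^ j) (fun _ : Fin d => Mc) *ᵥ β = 0 →
      (1 / 2 : ℂ) * (star (CurlOp (fine (L ^ j) fun _ : Fin d => Mc) ((L ^ j : ℕ) : ℂ) *ᵥ β)
        ⬝ᵥ (CurlOp (fine (L ^ j) fun _ : Fin d => Mc) ((L ^ j : ℕ) : ℂ) *ᵥ toB5 ξ)) = star β ⬝ᵥ J := by
    intro β hβ
    rw [curlForm_natCast, mul_left_comm, hw1 β hβ, hJ, dotProduct_smul, smul_eq_mul]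
  have hJim : ∀ p, conj (J p) = -J p := fun p => by
    rw [hJ, Pi.smul_apply, smul_eq_mul, map_mul, map_pow, map_natCast, toB5_imaginary hhs, mul_neg]
  have hJg : ∀ p, ‖J p‖ ≤ ((L ^ j : ℕ) : ℝ) ^ 2 * g := fun p => by
    obtain ⟨x, κ⟩ := p
    rw [hJ, Pi.smul_apply, norm_smul, norm_pow, Complex.norm_natCast, norm_toB5]
    exact mul_le_mul_of_nonneg_left (hhg _ _) (by positivity)
  -- the lit-balaban letter, at the class of `z`
  have hcurl := hB (toB5 ξ) J hαim hJim hαQ hwn (((L ^ j : ℕ) : ℝ) ^ 2 * g) hJg (mkT (L ^ j * Mc) z) μ ν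
  have hread : (CurlOp (fine (L ^ j) fun _ : Fin d => Mc) ((L ^ j : ℕ) : ℂ) *ᵥ toB5 ξ) (mkT (L ^ j * Mc) z, (μ, ν))
      = ((L ^ j : ℕ) : ℂ) * (curlAt (flat (d := d) (n := Fin 1)) ξ z μ ν) 0 0 := by
    have e := CurlOp_mulVec_toB5 (P := L ^ j * Mc) hP ((L ^ j : ℕ) : ℂ) hξP (mkT (L ^ j * Mc) z) μ ν
    rw [curlAt_flat_liftT_mkT (L ^ j * Mc) hξP] at e
    exact e
  rw [hread, norm_mul, Complex.norm_natCast, ← norm_fin_one] at hcurl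
  have hnpos : (0 : ℝ) < ((L ^ j : ℕ) : ℝ) := by exact_mod_cast Nat.pos_of_ne_zero (NeZero.ne _)
  refine le_of_mul_le_mul_left ?_ hnpos
  calc ((L ^ j : ℕ) : ℝ) * ‖curlAt (flat (d := d) (n := Fin 1)) ξ z μ ν‖ ≤ K * (((L ^ j : ℕ) : ℝ) ^ 2 * g) := hcurl
    _ = ((L ^ j : ℕ) : ℝ) * ((((L ^ j : ℕ) : ℝ) * K) * g) := by ring

/-! ## §4 The same from a bound on `Δ_a`'s constrained weak solutions, or on any constrained solution operator -/

/-- **`h1src` FROM A SUP BOUND ON THE CURL OF `Δ_a`'s CONSTRAINED WEAK SOLUTIONS** (every `a`): by (146) `weak_DeltaA_gaugeT_lambda0` each curl-only constrained weak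
solution has a gauge relative in `ker Q_k` with the same curl solving `Δ_a`'s constrained weak equation, so the letter may be stated for the latter. [folklore] -/
theorem rankOneSourceSolver_of_DeltaA_weak_bound {L : ℕ} [NeZero L] (hL : 1 ≤ L) (j Mc : ℕ) [NeZero Mc] (hP : 2 ≤ L ^ j * Mc) (a : ℝ) {K : ℝ}
    (hA : ∀ A J : Tor (fine (L ^ j) fun _ : Fin d => Mc) × Fin d → ℂ, QvOp (L ^ j) (fun _ : Fin d => Mc) *ᵥ A = 0 →
      (∀ β : Tor (fine (L ^ j) fun _ : Fin d => Mc) × Fin d → ℂ, QvOp (L ^ j) (fun _ : Fin d => Mc) *ᵥ β = 0 →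
        star β ⬝ᵥ (DeltaA (L ^ j) (fun _ : Fin d => Mc) a *ᵥ A) = star β ⬝ᵥ J) →
      ∀ g : ℝ, (∀ p, ‖J p‖ ≤ g) →
        ∀ (x : Tor (fine (L ^ j) fun _ : Fin d => Mc)) (μ ν : Fin d),
          ‖(CurlOp (fine (L ^ j) fun _ : Fin d => Mc) ((L ^ j : ℕ) : ℂ) *ᵥ A) (x, (μ, ν))‖ ≤ K * g) :
    ∀ ξ : Site d → Fin d → 𝕄₁, IsSkewDir ξ → IsPeriodicDir ξ ((L ^ j * Mc : ℕ) : ℤ) → (Qcoarse L)^[j] ξ = 0 →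
      ∀ h : Site d → Fin d → 𝕄₁, IsSkewDir h → IsPeriodicDir h ((L ^ j * Mc : ℕ) : ℤ) → ∀ g : ℝ, 0 ≤ g → (∀ (x : Site d) (κ : Fin d), ‖h x κ‖ ≤ g) →
      (∀ ζ : Site d → Fin d → 𝕄₁, IsSkewDir ζ → IsPeriodicDir ζ ((L ^ j * Mc : ℕ) : ℤ) → (Qcoarse L)^[j] ζ = 0 →
        hess (flat (d := d) (n := Fin 1)) ξ ζ (perWin d (L ^ j * Mc)) = srcPair h ζ (periodBox (d := d) (L ^ j * Mc))) →
      ∀ (z : Site d) (μ ν : Fin d), μ ≠ ν → ‖curlAt (flat (d := d) (n := Fin 1)) ξ z μ ν‖ ≤ (((L ^ j : ℕ) : ℝ) * K) * g := by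
  refine rankOneSourceSolver_of_B5 hL j Mc hP fun α J _ _ hαQ hw g hJ x μ ν => ?_
  obtain ⟨hQ', hC', hW'⟩ := weak_DeltaA_gaugeT_lambda0 (L ^ j) (fun _ : Fin d => Mc) a hαQ hw
  rw [← hC']
  exact hA _ J hQ' hW' g hJ x μ ν

/-- **`h1src` FROM ANY CONSTRAINED SOLUTION OPERATOR OF `Δ_a` WITH A SUP → SUP CURL BOUND** (`1 ≤ L^j` automatic, `0 < a`): if `C J ∈ ker Q_k` solves `Δ_a`'s constrained weak
equation for every `J` (the constrained Green field `GJ − GQ*(QGQ*)⁻¹QGJ` of (140) does) and `|∂_n(CJ)| ≤ K·sup|J|`, then (142)'s `h1src` holds with `K₁ = L^j·K` — by uniqueness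
((146) `eq_of_weak_DeltaA`) every constrained weak solution IS `C J`. [folklore] -/
theorem rankOneSourceSolver_of_solutionOperator {L : ℕ} [NeZero L] (hL : 1 ≤ L) (j Mc : ℕ) [NeZero Mc] (hP : 2 ≤ L ^ j * Mc) {a : ℝ} (ha : 0 < a) {K : ℝ}
    (C : (Tor (fine (L ^ j) fun _ : Fin d => Mc) × Fin d → ℂ) → (Tor (fine (L ^ j) fun _ : Fin d => Mc) × Fin d → ℂ))
    (hCQ : ∀ J, QvOp (L ^ j) (fun _ : Fin d => Mc) *ᵥ C J = 0)
    (hCw : ∀ J (β : Tor (fine (L ^ j) fun _ : Fin d => Mc) × Fin d → ℂ), QvOp (L ^ j) (fun _ : Fin d => Mc) *ᵥ β = 0 →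
      star β ⬝ᵥ (DeltaA (L ^ j) (fun _ : Fin d => Mc) a *ᵥ C J) = star β ⬝ᵥ J)
    (hCb : ∀ J (g : ℝ), (∀ p, ‖J p‖ ≤ g) → ∀ (x : Tor (fine (L ^ j) fun _ : Fin d => Mc)) (μ ν : Fin d),
      ‖(CurlOp (fine (L ^ j) fun _ : Fin d => Mc) ((L ^ j : ℕ) : ℂ) *ᵥ C J) (x, (μ, ν))‖ ≤ K * g) :
    ∀ ξ : Site d → Fin d → 𝕄₁, IsSkewDir ξ → IsPeriodicDir ξ ((L ^ j * Mc : ℕ) : ℤ) → (Qcoarse L)^[j] ξ = 0 →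
      ∀ h : Site d → Fin d → 𝕄₁, IsSkewDir h → IsPeriodicDir h ((L ^ j * Mc : ℕ) : ℤ) → ∀ g : ℝ, 0 ≤ g → (∀ (x : Site d) (κ : Fin d), ‖h x κ‖ ≤ g) →
      (∀ ζ : Site d → Fin d → 𝕄₁, IsSkewDir ζ → IsPeriodicDir ζ ((L ^ j * Mc : ℕ) : ℤ) → (Qcoarse L)^[j] ζ = 0 →
        hess (flat (d := d) (n := Fin 1)) ξ ζ (perWin d (L ^ j * Mc)) = srcPair h ζ (periodBox (d := d) (L ^ j * Mc))) →
      ∀ (z : Site d) (μ ν : Fin d), μ ≠ ν → ‖curlAt (flat (d := d) (n := Fin 1)) ξ z μ ν‖ ≤ (((L ^ j : ℕ) : ℝ) * K) * g := by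
  refine rankOneSourceSolver_of_DeltaA_weak_bound hL j Mc hP a fun A J hAQ hAw g hJ x μ ν => ?_
  have hn : 1 ≤ L ^ j := Nat.one_le_iff_ne_zero.mpr (NeZero.ne _)
  rw [eq_of_weak_DeltaA (L ^ j) (fun _ : Fin d => Mc) hn a ha hAQ (hCQ J) hAw (hCw J)]
  exact hCb J g hJ x μ ν

/-! ## §5 The (A)-bill's XL(c) as ONE sup → sup bound for Bałaban's constrained Green operator -/

/-- **`h1src` FROM A SUP → SUP CURL BOUND FOR BAŁABAN's CONSTRAINED GREEN OPERATOR** `C = G − GQ*(QGQ*)⁻¹QG`, `G = Δ_a⁻¹` ((148) `NE7StraightSliceB5Green.cGreen`;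
`Q·C = 0` and `⟨β, Δ_a(CJ)⟩ = ⟨β, J⟩` on `ker Q_k` are PROVED there): if `|∂_n(CJ)| ≤ K·g` pointwise whenever `|J| ≤ g` pointwise (`n = L^j`, `0 < a`), then (142)'s
`h1src` holds with `K₁ = L^j·K`.  THIS HYPOTHESIS `hGb` IS THE WHOLE REMAINING CONTENT OF THE (A)-BILL's XL(c) (memo §8: lit-balaban (1.115)₂ + the `𝒟⁻¹` term). [folklore] -/
theorem rankOneSourceSolver_of_cGreen_bound {L : ℕ} [NeZero L] (hL : 1 ≤ L) (j Mc : ℕ) [NeZero Mc] (hP : 2 ≤ L ^ j * Mc) {a : ℝ} (ha : 0 < a) {K : ℝ}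
    (hGb : ∀ (J : Tor (fine (L ^ j) fun _ : Fin d => Mc) × Fin d → ℂ) (g : ℝ), (∀ p, ‖J p‖ ≤ g) →
      ∀ (x : Tor (fine (L ^ j) fun _ : Fin d => Mc)) (μ ν : Fin d),
        ‖(CurlOp (fine (L ^ j) fun _ : Fin d => Mc) ((L ^ j : ℕ) : ℂ) *ᵥ (cGreen (L ^ j) (fun _ : Fin d => Mc) a *ᵥ J)) (x, (μ, ν))‖ ≤ K * g) :
    ∀ ξ : Site d → Fin d → 𝕄₁, IsSkewDir ξ → IsPeriodicDir ξ ((L ^ j * Mc : ℕ) : ℤ) → (Qcoarse L)^[j] ξ = 0 →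
      ∀ h : Site d → Fin d → 𝕄₁, IsSkewDir h → IsPeriodicDir h ((L ^ j * Mc : ℕ) : ℤ) → ∀ g : ℝ, 0 ≤ g → (∀ (x : Site d) (κ : Fin d), ‖h x κ‖ ≤ g) →
      (∀ ζ : Site d → Fin d → 𝕄₁, IsSkewDir ζ → IsPeriodicDir ζ ((L ^ j * Mc : ℕ) : ℤ) → (Qcoarse L)^[j] ζ = 0 →
        hess (flat (d := d) (n := Fin 1)) ξ ζ (perWin d (L ^ j * Mc)) = srcPair h ζ (periodBox (d := d) (L ^ j * Mc))) →
      ∀ (z : Site d) (μ ν : Fin d), μ ≠ ν → ‖curlAt (flat (d := d) (n := Fin 1)) ξ z μ ν‖ ≤ (((L ^ j : ℕ) : ℝ) * K) * g :=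
  have hn : 1 ≤ L ^ j := Nat.one_le_iff_ne_zero.mpr (NeZero.ne _)
  rankOneSourceSolver_of_solutionOperator hL j Mc hP ha (fun J => cGreen (L ^ j) (fun _ : Fin d => Mc) a *ᵥ J)
    (QvOp_mulVec_cGreen (L ^ j) (fun _ : Fin d => Mc) a ha) (fun J _ hβ => form_DeltaA_cGreen (L ^ j) (fun _ : Fin d => Mc) a hn ha J hβ) hGb

/-! ## §6 … and as BAŁABAN's THREE PRINTED SUP BOUNDS ((1.115) for `G`, the gradient bound for `H_k`) -/

/-- **`h1src` FROM BAŁABAN's THREE SUP BOUNDS** ((149) `NE7StraightSliceB5GreenSplit`): if on `Tor (fine L^j (N,…,N))`, at lattice factor `n = L^j`, `|∂_n(GJ)| ≤ C₁·|J|_∞`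
and `|GJ| ≤ C₀·|J|_∞` ((1.115) for `G = calG = Δ_a⁻¹`) and `|∂_n(H_kB)| ≤ C_H·|B|_∞` (`H_k = GQ*(QGQ*)⁻¹`, (1.103), the β sub-cell's `Hk`), then (142)'s `h1src` holds with
`K₁ = L^j·(C₁ + C_H·C₀)` (`0 < a`). These three displayed bounds ARE the (A)-bill's XL(c). [cite: Balaban1984PropagatorsI, (1.103) p.34, (1.115) p.36] -/
theorem rankOneSourceSolver_of_threeBounds {L : ℕ} [NeZero L] (hL : 1 ≤ L) (j Mc : ℕ) [NeZero Mc] (hP : 2 ≤ L ^ j * Mc) {a : ℝ} (ha : 0 < a) {C₁ C₀ CH : ℝ}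
    (hG1 : ∀ (J : Tor (fine (L ^ j) fun _ : Fin d => Mc) × Fin d → ℂ) (g : ℝ), (∀ p, ‖J p‖ ≤ g) →
      ∀ q, ‖(CurlOp (fine (L ^ j) fun _ : Fin d => Mc) ((L ^ j : ℕ) : ℂ) *ᵥ
        (calG (L ^ j) (Nat.one_le_iff_ne_zero.mpr (NeZero.ne _)) (fun _ : Fin d => Mc) a ha *ᵥ J)) q‖ ≤ C₁ * g)
    (hG0 : ∀ (J : Tor (fine (L ^ j) fun _ : Fin d => Mc) × Fin d → ℂ) (g : ℝ), (∀ p, ‖J p‖ ≤ g) →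
      ∀ p, ‖(calG (L ^ j) (Nat.one_le_iff_ne_zero.mpr (NeZero.ne _)) (fun _ : Fin d => Mc) a ha *ᵥ J) p‖ ≤ C₀ * g)
    (hH1 : ∀ (B : Tor (fun _ : Fin d => Mc) × Fin d → ℂ) (g : ℝ), (∀ p, ‖B p‖ ≤ g) →
      ∀ q, ‖(CurlOp (fine (L ^ j) fun _ : Fin d => Mc) ((L ^ j : ℕ) : ℂ) *ᵥ
        (Hk (L ^ j) (Nat.one_le_iff_ne_zero.mpr (NeZero.ne _)) (fun _ : Fin d => Mc) a ha *ᵥ B)) q‖ ≤ CH * g) :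
    ∀ ξ : Site d → Fin d → 𝕄₁, IsSkewDir ξ → IsPeriodicDir ξ ((L ^ j * Mc : ℕ) : ℤ) → (Qcoarse L)^[j] ξ = 0 →
      ∀ h : Site d → Fin d → 𝕄₁, IsSkewDir h → IsPeriodicDir h ((L ^ j * Mc : ℕ) : ℤ) → ∀ g : ℝ, 0 ≤ g → (∀ (x : Site d) (κ : Fin d), ‖h x κ‖ ≤ g) →
      (∀ ζ : Site d → Fin d → 𝕄₁, IsSkewDir ζ → IsPeriodicDir ζ ((L ^ j * Mc : ℕ) : ℤ) → (Qcoarse L)^[j] ζ = 0 →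
        hess (flat (d := d) (n := Fin 1)) ξ ζ (perWin d (L ^ j * Mc)) = srcPair h ζ (periodBox (d := d) (L ^ j * Mc))) →
      ∀ (z : Site d) (μ ν : Fin d), μ ≠ ν → ‖curlAt (flat (d := d) (n := Fin 1)) ξ z μ ν‖ ≤ (((L ^ j : ℕ) : ℝ) * (C₁ + CH * C₀)) * g := by
  obtain ⟨hCQ, hCw⟩ := cSplit_solutionOperator (L ^ j) (Nat.one_le_iff_ne_zero.mpr (NeZero.ne _)) (fun _ : Fin d => Mc) a ha
  exact rankOneSourceSolver_of_solutionOperator hL j Mc hP ha _ hCQ hCw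
    (fun J g hJ x μ ν => curl_cSplit_bound (L ^ j) (Nat.one_le_iff_ne_zero.mpr (NeZero.ne _)) (fun _ : Fin d => Mc) a ha _ hG1 hG0 hH1 J g hJ (x, (μ, ν)))

/-! ## §7 … and as (1.115) for `G` plus ONE sup bound for `(QGQ*)⁻¹` -/

/-- **`h1src` FROM (1.115) FOR `G` AND A SUP BOUND FOR `(QGQ*)⁻¹`** ((150) `NE7StraightSliceB5AdjointSup.curl_Hk_bound` feeds §6): on `Tor (fine L^j (N,…,N))` at lattice factor
`n = L^j`, from `hG1 : |∂_n(GJ)| ≤ C₁·|J|_∞`, `hG0 : |GJ| ≤ C₀·|J|_∞` ((1.115) for `G = Δ_a⁻¹`, PROVED in lit-balaban on the family of record) and `hE : |(QGQ*)⁻¹B| ≤ C_E·|B|_∞`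
(B5's `𝒟⁻¹` in sup norm — the ONE input lit-balaban does not yet hold), (142)'s `h1src` holds with `K₁ = L^j·(C₁ + (C₁·C_E)·C₀)` (`0 < a`). [cite: Balaban1984PropagatorsI, (1.103) p.34, (1.115) p.36] -/
theorem rankOneSourceSolver_of_G115_QGQinv {L : ℕ} [NeZero L] (hL : 1 ≤ L) (j Mc : ℕ) [NeZero Mc] (hP : 2 ≤ L ^ j * Mc) {a : ℝ} (ha : 0 < a) {C₁ C₀ CE : ℝ}
    (hG1 : ∀ (J : Tor (fine (L ^ j) fun _ : Fin d => Mc) × Fin d → ℂ) (g : ℝ), (∀ p, ‖J p‖ ≤ g) →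
      ∀ q, ‖(CurlOp (fine (L ^ j) fun _ : Fin d => Mc) ((L ^ j : ℕ) : ℂ) *ᵥ
        (calG (L ^ j) (Nat.one_le_iff_ne_zero.mpr (NeZero.ne _)) (fun _ : Fin d => Mc) a ha *ᵥ J)) q‖ ≤ C₁ * g)
    (hG0 : ∀ (J : Tor (fine (L ^ j) fun _ : Fin d => Mc) × Fin d → ℂ) (g : ℝ), (∀ p, ‖J p‖ ≤ g) →
      ∀ p, ‖(calG (L ^ j) (Nat.one_le_iff_ne_zero.mpr (NeZero.ne _)) (fun _ : Fin d => Mc) a ha *ᵥ J) p‖ ≤ C₀ * g)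
    (hE : ∀ (B : Tor (fun _ : Fin d => Mc) × Fin d → ℂ) (g : ℝ), (∀ p, ‖B p‖ ≤ g) →
      ∀ p, ‖((QGQ (L ^ j) (Nat.one_le_iff_ne_zero.mpr (NeZero.ne _)) (fun _ : Fin d => Mc) a ha)⁻¹ *ᵥ B) p‖ ≤ CE * g) :
    ∀ ξ : Site d → Fin d → 𝕄₁, IsSkewDir ξ → IsPeriodicDir ξ ((L ^ j * Mc : ℕ) : ℤ) → (Qcoarse L)^[j] ξ = 0 →
      ∀ h : Site d → Fin d → 𝕄₁, IsSkewDir h → IsPeriodicDir h ((L ^ j * Mc : ℕ) : ℤ) → ∀ g : ℝ, 0 ≤ g → (∀ (x : Site d) (κ : Fin d), ‖h x κ‖ ≤ g) →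
      (∀ ζ : Site d → Fin d → 𝕄₁, IsSkewDir ζ → IsPeriodicDir ζ ((L ^ j * Mc : ℕ) : ℤ) → (Qcoarse L)^[j] ζ = 0 →
        hess (flat (d := d) (n := Fin 1)) ξ ζ (perWin d (L ^ j * Mc)) = srcPair h ζ (periodBox (d := d) (L ^ j * Mc))) →
      ∀ (z : Site d) (μ ν : Fin d), μ ≠ ν → ‖curlAt (flat (d := d) (n := Fin 1)) ξ z μ ν‖ ≤ (((L ^ j : ℕ) : ℝ) * (C₁ + C₁ * CE * C₀)) * g :=
  rankOneSourceSolver_of_threeBounds hL j Mc hP ha hG1 hG0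
    (curl_Hk_bound (L ^ j) (fun _ : Fin d => Mc) (Nat.one_le_iff_ne_zero.mpr (NeZero.ne _)) a ha _ hG1 hE)

end

end Summit.QuantumFields.BalabanUV.T4Continuum.NE7StraightSliceB5Transfer
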